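import Summits.MatrixMultiplication.MatrixMultiplication.Theorems.GradedDesignFamily.Negative.SubfieldCellNineLambdaCert

/-!
# Subfield cell `GL₂(𝔽₉) ⊃ SL₂(𝔽₃)` at level one — III: `|Y| ≥ 2 ⇒ |Z| ≤ 17` (standard model)

**Honest framing.** VALUE = a kernel-checked finite certificate about ONE finite cell of
ONE skeleton line (`quadratic_extension_level_one_cell`, stub S3 `stub_subfieldCell`, crux
`GradedDesignFamily` of route `LevelGradedCohnUmans`), in the *standard model*
`(k, K, φ) = (𝔽₃, 𝔽₉, mapGL)`.  It is **not** progress on `Summit.MatrixMultiplication` (no bound on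
`ω` is touched) and it does **not** refute `stub_subfieldCell`, whose quantifiers
`∃ c > 0, ∀ N, ∃ (k, K, φ) …` are insensitive to any single cell.

## The theorem

`IsSep Y Z` is *literally* the separation clause of `stub_subfieldCell` for
`(k, K, φ) = (𝔽₃, 𝔽₉, Matrix.SpecialLinearGroup.mapGL 𝔽₉)`.  We prove

* `isSep_card_le : IsSep Y Z → 2 ≤ Y.card → Z.card ≤ 17`, and
* `subfieldCell_nine_std_no_2x18 : ¬ ∃ Y Z, 2 ≤ Y.card ∧ 18 ≤ Z.card ∧ IsSep Y Z`.

The bound is sharp: `subfieldCell_nine_witnessD` (p203235) is a separated pair with `|Y| = 2`,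
`|Z| = 17` in the same model.  Together with the wall `subfieldCell_nine_wall` (`|Y|+|Z| ≤ 21`,
arbitrary injective `φ`) this settles the row `|Y| = 2` of the `q = 3` cell for the standard
embedding; other embeddings `φ` are not treated here.

## Proof (λ-capacity argument)

WLOG `1 ∈ Z` (`IsSep.translate`).  Fix `y₁ ≠ y₂ ∈ Y`, `u = y₂y₁⁻¹`.  Pairing the design's
coefficient function `cf_{z₀}` with λ-vectors through `two_Theta` gives, for `z ∈ Z`,
`⟨w_{uz}, E_{z₀}⟩ = 0 = ⟨w_{u⁻¹z}, E_{z₀}⟩` and `⟨w_z, E_{z₀}⟩ = 4·[z = z₀]`.  Suppose `|Z| ≥ 18`.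
(A) `{w_z}_{z ∈ Z} ∪ {w_u}` are then `|Z|+1 ≥ 19` independent vectors in the hyperplane
`Σ_i = 0` of `ℂ^20` (`fact_hyper`), so each `w_{xz}` (`x ∈ {u, u⁻¹}`), orthogonal to every `E_{z₀}`,
is a multiple of `w_u`: `u` is *thin* and `Z ⊆ pool(u)` (`kprop_of_smul`).  (B) The certificate
functional `Φ` of `cert_exists` (file IIb) vanishes on `w_u` and on all `w_z`, `z ∈ Z`; with `Σ_i` this puts
`|Z|+1 ≥ 19` independent vectors inside an `18`-dimensional subspace — contradiction.

Independent cross-checks of the verdict `(2,18)` FALSE in this model: gen-8 exhaustive exact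
certificate `cert_q3_2x18_negative.json` (sha256 `e91fe18460368112b697356a27fe030fefcae21fb3fd5c1b8e6669004d433652`)
and `cert_q3_2x18_lamcap_s0of1.json` (sha256 `99147802…29f6ec2`), Python, under
`run/shared/lean/b2b/levelgraded-cu/b2b-lgcu-subfield-g8/certs/`.
-/

set_option linter.dupNamespace false

namespace Summit.MatrixMultiplication.MatrixMultiplication.Theorems.GradedDesignFamily.Negative.SubfieldNine

open Matrix

/-! ### Separated designs in the standard model -/

/-- The level-one separation clause of `stub_subfieldCell` for `(k, K, φ) = (𝔽₃, 𝔽₉, mapGL)`. -/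
def IsSep (Y Z : Finset (GL (Fin 2) K)) : Prop :=
  ∀ z₀ ∈ Z, ∃ cf : Vec → Vec → ℂ, ∀ a : SL3, ∀ y ∈ Y, ∀ y' ∈ Y, ∀ z ∈ Z,
    (∑ u : Vec, cf u (((Matrix.SpecialLinearGroup.mapGL K a * y * y'⁻¹ * z : GL (Fin 2) K) : Mat) *ᵥ u)) =
      if a = 1 ∧ y = y' ∧ z = z₀ then 1 else 0

/-- Right translation `Z ↦ Z·z₁⁻¹` preserves separation (`cf'(u,v) = cf(z₁⁻¹u, v)`). -/
theorem IsSep.translate {Y Z : Finset (GL (Fin 2) K)} (h : IsSep Y Z) (z₁ : GL (Fin 2) K) :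
    IsSep Y (Z.image (· * z₁⁻¹)) := by
  intro z₀' hz₀'
  obtain ⟨z₀, hz₀, rfl⟩ := Finset.mem_image.mp hz₀'
  obtain ⟨cf, hcf⟩ := h z₀ hz₀
  refine ⟨fun u v => cf (((z₁⁻¹ : GL (Fin 2) K) : Mat) *ᵥ u) v, ?_⟩
  intro a y hy y' hy' z' hz'
  obtain ⟨z, hz, rfl⟩ := Finset.mem_image.mp hz'
  have hbij : Function.Bijective fun u : Vec => ((z₁ : GL (Fin 2) K) : Mat) *ᵥ u := by
    refine (Finite.injective_iff_bijective).mp fun u u' huu => ?_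
    have := congrArg (fun v => ((z₁⁻¹ : GL (Fin 2) K) : Mat) *ᵥ v) huu
    simpa only [Matrix.mulVec_mulVec, ← Units.val_mul, inv_mul_cancel, Units.val_one,
      Matrix.one_mulVec] using this
  rw [← Fintype.sum_bijective _ hbij (fun u => cf (((z₁⁻¹ : GL (Fin 2) K) : Mat) *ᵥ
      (((z₁ : GL (Fin 2) K) : Mat) *ᵥ u)) (((Matrix.SpecialLinearGroup.mapGL K a * y * y'⁻¹ *
      (z * z₁⁻¹) : GL (Fin 2) K) : Mat) *ᵥ (((z₁ : GL (Fin 2) K) : Mat) *ᵥ u))) _ (fun _ => rfl)]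
  simp only [Matrix.mulVec_mulVec, ← Units.val_mul, inv_mul_cancel, Units.val_one,
    Matrix.one_mulVec]
  rw [mul_assoc _ (z * z₁⁻¹) z₁, inv_mul_cancel_right, hcf a y hy y' hy' z hz]
  simp only [mul_left_inj]

/-- Matrix of `φ(a) y y'⁻¹ z` in terms of `phiM`. -/
theorem coe_conj (a : SL3) (y y' z : GL (Fin 2) K) :
    ((Matrix.SpecialLinearGroup.mapGL K a * y * y'⁻¹ * z : GL (Fin 2) K) : Mat) =
      phiM a * (((y * y'⁻¹ : GL (Fin 2) K) : Mat) * (z : Mat)) := by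
  rw [phiM_eq]; simp only [Units.val_mul, mul_assoc]

/-- The bilinear pairing with a fixed dual vector, as a linear functional. -/
noncomputable def pairL (E : Idx → ℂ) : (Idx → ℂ) →ₗ[ℂ] ℂ where
  toFun x := ∑ i, x i * E i
  map_add' x y := by simp [add_mul, Finset.sum_add_distrib]
  map_smul' c x := by simp [Finset.mul_sum, mul_assoc]

/-- Unfolding `pairL`. -/
theorem pairL_apply (E x : Idx → ℂ) : pairL E x = ∑ i, x i * E i := rfl

/-- `⟨w_r, E(cf)⟩ = 2Θ_r(cf)` (the compression identity). -/
theorem pairL_w (cf : Vec → Vec → ℂ) (r : Mat) : pairL (Edual cf) (w r) = 2 * Theta r cf := by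
  rw [pairL_apply, two_Theta]

/-- `w_g` lies in the hyperplane `Σ_i = 0` for a unit `g`. -/
theorem pairL_one_w (g : GL (Fin 2) K) : pairL (fun _ => 1) (w (g : Mat)) = 0 := by
  rw [pairL_apply]
  simp only [mul_one, w, ← map_sum]
  rw [fact_hyper _ (by rw [det2_eq]; exact Matrix.GeneralLinearGroup.det_ne_zero g), map_zero]

/-- `inv2` agrees with the group inverse on units. -/
theorem inv2_coe (g : GL (Fin 2) K) : inv2 (g : Mat) = ((g⁻¹ : GL (Fin 2) K) : Mat) := by
  have h := fact_inv2 (g : Mat) (by rw [det2_eq]; exact Matrix.GeneralLinearGroup.det_ne_zero g)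
  calc inv2 (g : Mat) = inv2 (g : Mat) * ((g : Mat) * ((g⁻¹ : GL (Fin 2) K) : Mat)) := by
        rw [← Units.val_mul, mul_inv_cancel, Units.val_one, mul_one]
    _ = ((g⁻¹ : GL (Fin 2) K) : Mat) := by rw [← mul_assoc, h, one_mul]

/-- Glueing lemma: an independent family killed by `f` plus preimages of an independent family. -/
theorem linIndep_sum_elim {V W ι κ : Type*} [AddCommGroup V] [Module ℂ V] [AddCommGroup W]
    [Module ℂ W] [Fintype ι] [Fintype κ] (f : V →ₗ[ℂ] W) (x : ι → V) (y : κ → V)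
    (hx : LinearIndependent ℂ x) (hfx : ∀ i, f (x i) = 0) (hy : LinearIndependent ℂ (f ∘ y)) :
    LinearIndependent ℂ (Sum.elim x y) := by
  rw [Fintype.linearIndependent_iff] at hx hy ⊢
  intro g hg
  rw [Fintype.sum_sum_type] at hg
  simp only [Sum.elim_inl, Sum.elim_inr] at hg
  have h1 : ∀ k, g (Sum.inr k) = 0 := by
    have := congrArg f hg
    simp only [map_add, map_sum, map_smul, hfx, smul_zero, Finset.sum_const_zero, zero_add,
      map_zero] at this
    exact hy (fun k => g (Sum.inr k)) this
  have h2 : ∀ i, g (Sum.inl i) = 0 := by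
    simp only [h1, zero_smul, Finset.sum_const_zero, add_zero] at hg
    exact hx _ hg
  rintro (i | k)
  exacts [h2 i, h1 k]

/-- `dim ℂ^20 = 20`. -/
theorem finrank_V : Module.finrank ℂ (Idx → ℂ) = 20 := by
  rw [Module.finrank_fintype_fun_eq_card]; rfl

/-- **Main lemma.** With `1 ∈ Z` and two distinct elements of `Y`: `|Z| ≤ 17`. -/
theorem card_le_of_one_mem {Y Z : Finset (GL (Fin 2) K)} (hsep : IsSep Y Z) {y₁ y₂ : GL (Fin 2) K}
    (hy₁ : y₁ ∈ Y) (hy₂ : y₂ ∈ Y) (hne : y₁ ≠ y₂) (h1 : (1 : GL (Fin 2) K) ∈ Z) : Z.card ≤ 17 := by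
  classical
  by_contra hlt
  push Not at hlt
  choose cf hcf using hsep
  set u : GL (Fin 2) K := y₂ * y₁⁻¹ with hu
  have hu' : u⁻¹ = y₁ * y₂⁻¹ := by rw [hu, _root_.mul_inv_rev, inv_inv]
  -- pairing facts
  have P1 : ∀ z₀ (h₀ : z₀ ∈ Z) z, z ∈ Z → pairL (Edual (cf z₀ h₀)) (w ((u * z : GL (Fin 2) K) : Mat)) = 0 := by
    intro z₀ h₀ z hz
    rw [pairL_w, Theta]
    have : ∀ h : SL3, ∑ x : Vec, cf z₀ h₀ x ((phiM h * ((u * z : GL (Fin 2) K) : Mat)) *ᵥ x) = 0 := by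
      intro h
      have e := hcf z₀ h₀ h y₂ hy₂ y₁ hy₁ z hz
      rw [coe_conj, ← Units.val_mul] at e
      rw [e, if_neg]
      rintro ⟨-, h', -⟩; exact hne h'.symm
    simp only [this, mul_zero, Finset.sum_const_zero]
  have P2 : ∀ z₀ (h₀ : z₀ ∈ Z) z, z ∈ Z → pairL (Edual (cf z₀ h₀)) (w ((u⁻¹ * z : GL (Fin 2) K) : Mat)) = 0 := by
    intro z₀ h₀ z hz
    rw [pairL_w, Theta]
    have : ∀ h : SL3, ∑ x : Vec, cf z₀ h₀ x ((phiM h * ((u⁻¹ * z : GL (Fin 2) K) : Mat)) *ᵥ x) = 0 := by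
      intro h
      have e := hcf z₀ h₀ h y₁ hy₁ y₂ hy₂ z hz
      rw [coe_conj, ← Units.val_mul, ← hu'] at e
      rw [e, if_neg]
      rintro ⟨-, h', -⟩; exact hne h'
    simp only [this, mul_zero, Finset.sum_const_zero]
  have P3 : ∀ z₀ (h₀ : z₀ ∈ Z) z, z ∈ Z → pairL (Edual (cf z₀ h₀)) (w (z : Mat)) = if z = z₀ then 4 else 0 := by
    intro z₀ h₀ z hz
    rw [pairL_w, Theta]
    have : ∀ h : SL3, ∑ x : Vec, cf z₀ h₀ x ((phiM h * (z : Mat)) *ᵥ x) =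
        if h = 1 then (if z = z₀ then 1 else 0) else 0 := by
      intro h
      have e := hcf z₀ h₀ h y₁ hy₁ y₁ hy₁ z hz
      rw [mul_inv_cancel_right, Units.val_mul, ← phiM_eq] at e
      rw [e]; simp only [true_and, ite_and]
    simp only [this, mul_ite, mul_one, mul_zero, Finset.sum_ite_eq', Finset.mem_univ,
      kexp_one, cval, if_pos, σ_two]
    split_ifs <;> norm_num
  -- Claim A: pool membership
  have claimA : ∀ x : GL (Fin 2) K, (x = u ∨ x = u⁻¹) → ∀ z₁ ∈ Z,
      ∃ c : ℂ, w ((x * z₁ : GL (Fin 2) K) : Mat) = c • w (u : Mat) := by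
    intro x hx z₁ hz₁
    have Px : ∀ z₀ (h₀ : z₀ ∈ Z) z, z ∈ Z → pairL (Edual (cf z₀ h₀)) (w ((x * z : GL (Fin 2) K) : Mat)) = 0 := by
      rcases hx with rfl | rfl
      exacts [P1, P2]
    by_contra hno
    push Not at hno
    let Zs := {z // z ∈ Z}
    let fam : Option (Option Zs) → (Idx → ℂ) := fun o =>
      match o with
      | none => w ((x * z₁ : GL (Fin 2) K) : Mat)
      | some none => w (u : Mat)
      | some (some z) => w ((z : GL (Fin 2) K) : Mat)
    have hfam : LinearIndependent ℂ fam := by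
      rw [Fintype.linearIndependent_iff]
      intro g hg
      have hz : ∀ z : Zs, g (some (some z)) = 0 := by
        intro z₀
        have := congrArg (pairL (Edual (cf z₀ z₀.2))) hg
        simp only [map_add, map_sum, map_smul, map_zero, Fintype.sum_option, fam, smul_eq_mul] at this
        rw [Px _ _ _ hz₁, show (u : Mat) = ((u * 1 : GL (Fin 2) K) : Mat) by rw [mul_one],
          P1 _ _ _ h1] at this
        simp only [mul_zero, zero_add, P3 _ _ _ (Subtype.mem _), mul_ite, mul_zero,
          Subtype.coe_inj] at this
        rw [Finset.sum_ite_eq'] at this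
        simpa using this
      simp only [Fintype.sum_option, hz, zero_smul, Finset.sum_const_zero, add_zero, fam] at hg
      by_cases hg0 : g none = 0
      · rw [hg0, zero_smul, zero_add] at hg
        have hg1 : g (some none) = 0 := (smul_eq_zero.mp hg).resolve_right (w_ne_zero u)
        rintro (_ | _ | z)
        exacts [hg0, hg1, hz z]
      · exfalso
        apply hno (-(g (some none)) / g none)
        funext i
        have hi := congrFun hg i
        simp only [Pi.add_apply, Pi.smul_apply, smul_eq_mul, Pi.zero_apply] at hi
        rw [Pi.smul_apply, smul_eq_mul]
        field_simp
        linear_combination hi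
    have hind := linIndep_sum_elim (pairL fun _ => 1) fam
      (fun _ : Unit => Pi.single ((0 : Fin 10), (0 : Fin 2)) 1) hfam
      (by rintro (_ | _ | z) <;> exact pairL_one_w _)
      (by
        rw [Fintype.linearIndependent_iff]
        intro g hg i
        rw [Fintype.sum_unique] at hg
        simp only [Function.comp_apply, pairL_apply, Pi.single_apply,
          Finset.sum_ite_eq', Finset.mem_univ, if_true, smul_eq_mul, mul_one] at hg
        cases i; exact hg)
    have := hind.fintype_card_le_finrank
    rw [finrank_V, Fintype.card_sum, Fintype.card_option, Fintype.card_option, Fintype.card_coe,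
      Fintype.card_unit] at this
    omega
  -- thinness and the pool
  have hdetu : det2 (u : Mat) ≠ 0 := by rw [det2_eq]; exact Matrix.GeneralLinearGroup.det_ne_zero u
  have hthin : kprop (vc (inv2 (u : Mat))) (vc (u : Mat)) := by
    obtain ⟨c, hc⟩ := claimA u⁻¹ (Or.inr rfl) 1 h1
    rw [mul_one] at hc
    rw [inv2_coe]; exact kprop_of_smul hc
  obtain ⟨Φ, ⟨i₁, i₂, hΦ⟩, hΦu, hΦpool⟩ := cert_exists hdetu hthin
  have hΦz : ∀ z ∈ Z, dotz Φ (vz ((z : GL (Fin 2) K) : Mat)) = 0 := by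
    intro z hz
    refine hΦpool _ ?_ ?_
    · obtain ⟨c, hc⟩ := claimA u (Or.inl rfl) z hz
      rw [mul2_eq, ← Units.val_mul]; exact kprop_of_smul hc
    · obtain ⟨c, hc⟩ := claimA u⁻¹ (Or.inr rfl) z hz
      rw [mul2_eq, inv2_coe, ← Units.val_mul]; exact kprop_of_smul hc
  -- Claim B: 19 independent vectors inside an 18-dimensional space
  have hΦL : ∀ r : Mat, dotz Φ (vz r) = 0 → pairL (fun i => (Φ i : ℂ)) (w r) = 0 := by
    intro r hr
    rw [pairL_apply]
    simp only [w, ← map_intCast σ, ← map_mul, ← map_sum]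
    rw [show (∑ i, vz r i * ((Φ i : ℤ) : ℤ√(-3))) = dotz Φ (vz r) from rfl, hr, map_zero]
  let Zs := {z // z ∈ Z}
  let fam : Option Zs → (Idx → ℂ) := fun o =>
    match o with
    | none => w (u : Mat)
    | some z => w ((z : GL (Fin 2) K) : Mat)
  have hfam : LinearIndependent ℂ fam := by
    rw [Fintype.linearIndependent_iff]
    intro g hg
    have hz : ∀ z : Zs, g (some z) = 0 := by
      intro z₀
      have := congrArg (pairL (Edual (cf z₀ z₀.2))) hg
      simp only [map_add, map_sum, map_smul, map_zero, Fintype.sum_option, fam, smul_eq_mul] at this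
      rw [show (u : Mat) = ((u * 1 : GL (Fin 2) K) : Mat) by rw [mul_one], P1 _ _ _ h1] at this
      simp only [mul_zero, zero_add, P3 _ _ _ (Subtype.mem _), mul_ite, mul_zero,
        Subtype.coe_inj] at this
      rw [Finset.sum_ite_eq'] at this
      simpa using this
    simp only [Fintype.sum_option, hz, zero_smul, Finset.sum_const_zero, add_zero, fam] at hg
    have hg0 : g none = 0 := (smul_eq_zero.mp hg).resolve_right (w_ne_zero u)
    rintro (_ | z)
    exacts [hg0, hz z]
  let f : (Idx → ℂ) →ₗ[ℂ] ℂ × ℂ := (pairL fun _ => 1).prod (pairL fun i => (Φ i : ℂ))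
  have hfe : ∀ i : Idx, f (Pi.single i 1) = (1, (Φ i : ℂ)) := fun i => by
    show ((pairL fun _ => (1 : ℂ)) (Pi.single i 1), (pairL fun i => (Φ i : ℂ)) (Pi.single i 1)) = _
    simp only [pairL_apply, Pi.single_apply, ite_mul, one_mul, zero_mul,
      Finset.sum_ite_eq', Finset.mem_univ, if_true]
  have hind := linIndep_sum_elim f fam ![Pi.single i₁ 1, Pi.single i₂ 1] hfam
    (by
      rintro (_ | z)
      · exact Prod.ext (pairL_one_w u) (hΦL _ hΦu)
      · exact Prod.ext (pairL_one_w _) (hΦL _ (hΦz _ z.2)))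
    (by
      rw [Fintype.linearIndependent_iff]
      intro g hg
      rw [Fin.sum_univ_two] at hg
      simp only [Function.comp_apply, Matrix.cons_val_zero, Matrix.cons_val_one,
        hfe, Prod.smul_mk, Prod.mk_add_mk, Prod.mk_eq_zero, smul_eq_mul, mul_one] at hg
      obtain ⟨h1', h2'⟩ := hg
      have hcast : (Φ i₁ : ℂ) ≠ (Φ i₂ : ℂ) := by exact_mod_cast hΦ
      have g0 : g 0 = 0 := by
        have : g 0 * ((Φ i₁ : ℂ) - (Φ i₂ : ℂ)) = 0 := by linear_combination h2' - (Φ i₂ : ℂ) * h1'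
        exact (mul_eq_zero.mp this).resolve_right (sub_ne_zero.mpr hcast)
      have g1 : g 1 = 0 := by rw [g0, zero_add] at h1'; exact h1'
      intro i; fin_cases i <;> assumption)
  have := hind.fintype_card_le_finrank
  rw [finrank_V, Fintype.card_sum, Fintype.card_option, Fintype.card_coe, Fintype.card_fin] at this
  omega

/-- **Row `|Y| ≥ 2` of the `q = 3` subfield cell in the standard model:** a level-one separated
pair `(Y, Z)` with `|Y| ≥ 2` has `|Z| ≤ 17` (and `17` is attained: `subfieldCell_nine_witnessD`). -/
theorem isSep_card_le (Y Z : Finset (GL (Fin 2) K)) (hsep : IsSep Y Z) (hY : 2 ≤ Y.card) :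
    Z.card ≤ 17 := by
  classical
  obtain ⟨y₁, hy₁, y₂, hy₂, hne⟩ := Finset.one_lt_card.mp hY
  rcases Z.eq_empty_or_nonempty with rfl | ⟨z₁, hz₁⟩
  · simp
  have h := card_le_of_one_mem (hsep.translate z₁) hy₁ hy₂ hne
    (Finset.mem_image.mpr ⟨z₁, hz₁, mul_inv_cancel z₁⟩)
  rwa [Finset.card_image_of_injective _ (mul_left_injective z₁⁻¹)] at h


/-- The `(2,18)` instance of the standard-model `q = 3` subfield cell is FALSE. -/
theorem subfieldCell_nine_std_no_2x18 :
    ¬ ∃ Y Z : Finset (GL (Fin 2) K), 2 ≤ Y.card ∧ 18 ≤ Z.card ∧ IsSep Y Z := by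
  rintro ⟨Y, Z, hY, hZ, hsep⟩
  have := isSep_card_le Y Z hsep hY
  omega

end Summit.MatrixMultiplication.MatrixMultiplication.Theorems.GradedDesignFamily.Negative.SubfieldNine
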